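import Literature.Analysis.OperatorTheory.ProjectionLowerBound
import HarnessLib

/-!
# Birman–Schwinger comparison count for Schrödinger-type pencils (operator-free counting form)

Topic `Literature/Analysis/OperatorTheory`; proofs-layer companion of `ProjectionLowerBound.lean` (Liu's
projection-based guaranteed lower eigenvalue bound, counting form).

The BIRMAN–SCHWINGER PRINCIPLE (Frank–Laptev–Weidl, *Schrödinger Operators: Eigenvalues and Lieb–Thirring
Inequalities* (2022), §1.2.8 Thm 1.52, proved from Glazman's lemma Thm 1.25 §1.2.3): for non-negative closed
forms `a`, `b` with `|b| ≤ M a`, the number of negative eigenvalues of `A − αB` equals the number of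
eigenvalues of the Birman–Schwinger operator `ℬ_a` above `1/α`. Validated eigenvalue computations for a
Schrödinger-type form `a = a₀ + v` (stiffness `a₀(w,w) = ∫|∇w|²`, bounded potential form
`0 ≤ v(w,w) = ∫V w² ≤ V_max·ms(w,w)`, mass `ms(w,w) = ∫w²`; e.g. the Grad–Shafranov operator `−Δ*` after the
substitution `u = √R·w`, `V = 3/(4R²)`) use exactly ONE direction of it, at the level `σ > V_max`, in Glazman's
variational dress: if the first `k` levels of `a` (w.r.t. `ms`) were all `< lo·σ` (`lo ≤ 1`), their span would be a
`k`-dimensional space on which `a₀ < lo·b_σ` for the POSITIVE form `b_σ := σ·ms − v` — i.e. the pencil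
`(a₀, b_σ)` would have at least `k` levels below `lo`. Combined with Liu's bound in span form
(`liu_count_bound_span`: a certified discrete coercivity of a comparison pair `a' ≤ a₀`, `b_σ ≤ b'` at level
`s` past `m < k` constraints, an `a'`-orthogonal projection with error constant `C`, force `s ≤ Λ(1 + C²s)` for
any `k`-dimensional trial family with Rayleigh quotient `a₀ ≤ Λ b_σ`), this gives the three statements a
certificate reader needs, with NO operator, NO compactness and NO essential spectrum in sight (pure linear
algebra over `ℝ`, as the companion file):

* `liu_schrodinger_count_bound` — the `Λ`-form: an `ms`-orthonormal, `a`-diagonal family of `k > m` vectors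
  with levels `λ_i ≤ Λσ`, `Λ ≤ 1`, forces `s ≤ Λ(1 + C²s)`;
* `exists_schrodinger_level_ge` — with a closing inequality `lo·(1 + C²s) ≤ s`, `lo ≤ 1` (the record
  `⟨s, C², lo⟩` of `Computation/Certificates/ProjectionEigenvalueCertificate.lean`), some level is `≥ lo·σ`;
* `card_schrodinger_lt_le` — counting form for a family of ANY size: at most `m` levels lie below `lo·σ`,
  i.e. `λ_{m+1}(a; ms) ≥ lo·σ` once the client's spectral theorem enumerates the exact eigenpairs.

Why the pencil and not the shifted form: for `−Δ + V` with a NON-CONSTANT potential the Crouzeix–Raviart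
interpolation is `∫∇·∇`-orthogonal elementwise but not `(∫∇·∇ + ∫V··)`-orthogonal; moving `V` into the
(positive, `σ`-dependent) mass `b_σ` keeps the principal part flat, so Liu's `horth` holds exactly and the
potential only enters `happrox` through `sup ρ_T` — the device of the certnum elliptic-eigenvalue chain
(«gs2»). HYPOTHESES A CLIENT STILL SUPPLIES: the comparison inequalities `a' ≤ a₀`, `σ·ms − v ≤ b'`
(elementwise tangent majorants of the concave `σ − V`), `a₀ + v ≤ a` (equality for a genuine Schrödinger
form), `0 ≤ v ≤ V_max·ms`, `V_max < σ`; the exact eigenfamily (spectral theorem); `horth`/`happrox`/`hcoer`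
on its span (finite elements: the PRINTED element constant, e.g. `0.1893 h_T` for Crouzeix–Raviart, is NOT
certified here). WHAT THIS IS NOT: the Birman–Schwinger principle as an EQUALITY of dimensions (only the
inequality that yields LOWER bounds is proved), Birman–Schwinger operators / resolvents, Lieb–Thirring or CLR
bounds, anything about unbounded `V`. Everything here is PROVED (standard axioms); no named facts.
[cite: FrankLaptevWeidl2022, Thm 1.52 (§1.2.8) with Thm 1.25 (§1.2.3)] [cite: Liu2015, Thm 2.1]
-/

namespace Literature.Analysis.OperatorTheory

open scoped BigOperators
open Finset

variable {V : Type*} [AddCommGroup V] [Module ℝ V]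

/-- **Rayleigh comparison on a Schrödinger eigen-span.** If `u_1..u_k` is `ms`-orthonormal and `a`-diagonal
with levels `λ_i ≤ Λσ`, `Λ ≤ 1`, and `a₀ + v ≤ a` with `v ≥ 0`, then on `φ = Σ c_i u_i` the pencil stiffness is
dominated by `Λ` times the Birman–Schwinger mass: `a₀(φ,φ) ≤ Λ·(σ·ms(φ,φ) − v(φ,φ))`. (Glazman's test space for
the pencil `(a₀, σ·ms − v)` built from the eigen-span of `a`.)
[cite: FrankLaptevWeidl2022, Thm 1.25 (§1.2.3, Glazman's lemma: the eigen-span as test space)] -/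
theorem schrodinger_span_rayleigh (a a₀ ms v : LinearMap.BilinForm ℝ V)
    (hv_nonneg : ∀ x, 0 ≤ v x x) (ha₀_le : ∀ x, a₀ x x + v x x ≤ a x x)
    {k : ℕ} (u : Fin k → V) (lam : Fin k → ℝ) {Λ σ : ℝ}
    (hms_on : ∀ i j, ms (u i) (u j) = if i = j then 1 else 0)
    (ha_on : ∀ i j, a (u i) (u j) = if i = j then lam i else 0)
    (hlam : ∀ i, lam i ≤ Λ * σ) (hΛ : Λ ≤ 1) (c : Fin k → ℝ) :
    a₀ (∑ i, c i • u i) (∑ i, c i • u i) ≤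
      Λ * (σ * ms (∑ i, c i • u i) (∑ i, c i • u i) - v (∑ i, c i • u i) (∑ i, c i • u i)) := by
  classical
  set φ : V := ∑ i, c i • u i with hφdef
  have hmsφ : ms φ φ = ∑ i, c i ^ 2 := by
    rw [hφdef, bilin_sum_sum_of_kronecker ms u (fun _ => (1 : ℝ)) (by simpa using hms_on) c]
    simp
  have haφ : a φ φ = ∑ i, lam i * c i ^ 2 := by
    rw [hφdef, bilin_sum_sum_of_kronecker a u lam ha_on c]
  have haΛ : a φ φ ≤ Λ * σ * ms φ φ := by
    rw [haφ, hmsφ, Finset.mul_sum]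
    exact Finset.sum_le_sum fun i _ => mul_le_mul_of_nonneg_right (hlam i) (sq_nonneg _)
  have hvφ := hv_nonneg φ
  have h1 : a₀ φ φ ≤ a φ φ - v φ φ := by linarith [ha₀_le φ]
  have h2 : (1 - Λ) * v φ φ ≥ 0 := mul_nonneg (by linarith) hvφ
  nlinarith

/-- **Positivity of the Birman–Schwinger mass on an `ms`-orthonormal span.** With `v ≤ V_max·ms`,
`(σ − V_max)·Σ c_i² ≤ σ·ms(φ,φ) − v(φ,φ)` for `φ = Σ c_i u_i`; in particular the form `σ·ms − v` is positive on
the non-zero members of the span when `V_max < σ` (hypothesis (1.63) of the Birman–Schwinger setting for the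
pencil mass). [cite: FrankLaptevWeidl2022, §1.2.8 assumption (H_α) (1.63)] -/
theorem schrodinger_span_mass_lower (ms v : LinearMap.BilinForm ℝ V) {Vmax σ : ℝ}
    (hv_le : ∀ x, v x x ≤ Vmax * ms x x)
    {k : ℕ} (u : Fin k → V) (hms_on : ∀ i j, ms (u i) (u j) = if i = j then 1 else 0)
    (c : Fin k → ℝ) :
    (σ - Vmax) * ∑ i, c i ^ 2 ≤
      σ * ms (∑ i, c i • u i) (∑ i, c i • u i) - v (∑ i, c i • u i) (∑ i, c i • u i) := by
  classical
  have hmsφ : ms (∑ i, c i • u i) (∑ i, c i • u i) = ∑ i, c i ^ 2 := by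
    rw [bilin_sum_sum_of_kronecker ms u (fun _ => (1 : ℝ)) (by simpa using hms_on) c]
    simp
  have hv := hv_le (∑ i, c i • u i)
  rw [hmsφ] at hv ⊢
  nlinarith

/-- **Liu's counting bound through the Birman–Schwinger pencil (`Λ`-form).** Let `a` be a Schrödinger-type
form with splitting `a₀ + v ≤ a` (`v ≥ 0`, `v ≤ V_max·ms`), `σ > V_max`, and `u_1..u_k` an `ms`-orthonormal,
`a`-diagonal family (exact eigenpairs of `a` w.r.t. the mass `ms`) with levels `λ_i ≤ Λσ`, `Λ ≤ 1`. Suppose a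
comparison pair `a' ≤ a₀`, `σ·ms − v ≤ b'` (`a'`, `b'` symmetric, `b' ⪰ 0`) carries Liu's data on `span u`:
an `a'`-orthogonal projection `proj` with error constant `b'(φ−Πφ,φ−Πφ) ≤ C² a'(φ−Πφ,φ−Πφ)` and the CERTIFIED
discrete coercivity `s·b'(Πφ,Πφ) ≤ a'(Πφ,Πφ)` past `m < k` linear constraints `ℓ_j`. Then
`s ≤ Λ(1 + C² s)`. (Glazman's eigen-span of `a` is a `k`-dimensional trial family with Rayleigh quotient
`a₀ ≤ Λ·(σ·ms − v)` — `schrodinger_span_rayleigh` — to which `liu_count_bound_span` applies.)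
[cite: FrankLaptevWeidl2022, Thm 1.52 (§1.2.8, Birman–Schwinger principle; the `≤` direction via Thm 1.25)]
[cite: Liu2015, Thm 2.1] -/
theorem liu_schrodinger_count_bound (a a₀ ms v a' b' : LinearMap.BilinForm ℝ V)
    (ha'_symm : ∀ x y, a' x y = a' y x) (hb'_symm : ∀ x y, b' x y = b' y x)
    (hb'_nonneg : ∀ x, 0 ≤ b' x x)
    (hv_nonneg : ∀ x, 0 ≤ v x x) {Vmax σ : ℝ} (hv_le : ∀ x, v x x ≤ Vmax * ms x x) (hσ : Vmax < σ)
    (ha₀_le : ∀ x, a₀ x x + v x x ≤ a x x)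
    {k m : ℕ} (hmk : m < k) (u : Fin k → V) (lam : Fin k → ℝ) {Λ C s : ℝ}
    (hms_on : ∀ i j, ms (u i) (u j) = if i = j then 1 else 0)
    (ha_on : ∀ i j, a (u i) (u j) = if i = j then lam i else 0)
    (hlam : ∀ i, lam i ≤ Λ * σ) (hΛ : Λ ≤ 1) (hC : 0 < C) (hs : 0 < s)
    (ha'_le : ∀ x, a' x x ≤ a₀ x x) (hb_le : ∀ x, σ * ms x x - v x x ≤ b' x x)
    (proj : V →ₗ[ℝ] V) (ℓ : Fin m → V →ₗ[ℝ] ℝ)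
    (horth : ∀ φ ∈ Submodule.span ℝ (Set.range u), a' (proj φ) (φ - proj φ) = 0)
    (happrox : ∀ φ ∈ Submodule.span ℝ (Set.range u),
      b' (φ - proj φ) (φ - proj φ) ≤ C ^ 2 * a' (φ - proj φ) (φ - proj φ))
    (hcoer : ∀ φ ∈ Submodule.span ℝ (Set.range u), (∀ j, ℓ j (proj φ) = 0) →
      s * b' (proj φ) (proj φ) ≤ a' (proj φ) (proj φ)) :
    s ≤ Λ * (1 + C ^ 2 * s) := by
  classical
  -- the Birman–Schwinger mass `b_σ = σ·ms − v` as a bilinear form, and the trial family `U c = Σ c_i u_i`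
  let bσ : LinearMap.BilinForm ℝ V := σ • ms - v
  have hbσ : ∀ x y, bσ x y = σ * ms x y - v x y := fun x y => by
    simp [bσ, LinearMap.sub_apply, LinearMap.smul_apply, smul_eq_mul]
  let U : (Fin k → ℝ) →ₗ[ℝ] V := Fintype.linearCombination ℝ u
  have hU : ∀ c : Fin k → ℝ, U c = ∑ i, c i • u i := fun c => by
    simp [U, Fintype.linearCombination_apply]
  have hUmem : ∀ c : Fin k → ℝ, U c ∈ Submodule.span ℝ (Set.range u) := fun c => by
    rw [hU]
    exact Submodule.sum_mem _ fun i _ => Submodule.smul_mem _ _ (Submodule.subset_span ⟨i, rfl⟩)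
  have hray : ∀ y, a₀ (U y) (U y) ≤ Λ * bσ (U y) (U y) := fun y => by
    rw [hbσ, hU]
    exact schrodinger_span_rayleigh a a₀ ms v hv_nonneg ha₀_le u lam hms_on ha_on hlam hΛ y
  have hbpos : ∀ y, y ≠ 0 → 0 < bσ (U y) (U y) := by
    intro y hy
    rw [hbσ, hU]
    have hlow := schrodinger_span_mass_lower ms v (σ := σ) hv_le u hms_on y
    obtain ⟨i, hi⟩ : ∃ i, y i ≠ 0 := by simpa using Function.ne_iff.mp hy
    have hle : y i ^ 2 ≤ ∑ j, y j ^ 2 :=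
      Finset.single_le_sum (f := fun j => y j ^ 2) (fun j _ => sq_nonneg (y j)) (Finset.mem_univ i)
    have hyi : 0 < y i ^ 2 := by positivity
    have hsum : 0 < ∑ j, y j ^ 2 := lt_of_lt_of_le hyi hle
    have hgap : 0 < σ - Vmax := by linarith
    nlinarith [mul_pos hgap hsum]
  exact liu_count_bound_span a₀ bσ a' b' ha'_symm hb'_symm hb'_nonneg hmk U hray hbpos
    (fun y => ha'_le (U y)) (fun y => by rw [hbσ]; exact hb_le (U y)) hC hs proj ℓ
    (fun y => horth (U y) (hUmem y)) (fun y => happrox (U y) (hUmem y))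
    (fun y hy => hcoer (U y) (hUmem y) hy)

/-- **Some Schrödinger level is `≥ lo·σ`.** Same setting; if the certified data close Liu's row with
`lo ≤ 1`, i.e. `lo·(1 + C²s) ≤ s` (so the pencil `(a₀, σ·ms − v)` has `μ_{m+1} ≥ s/(1 + C²s) ≥ lo`), then among
any `k > m` `ms`-orthonormal `a`-diagonal vectors at least one has level `≥ lo·σ`: the Birman–Schwinger step
«`λ_k(a) < σ` ⇒ `μ_k(σ) < 1`» in contrapositive, counting form, with the slack `lo`.
[cite: FrankLaptevWeidl2022, Thm 1.52 (§1.2.8) with Thm 1.25 (§1.2.3)] [cite: Liu2015, Thm 2.1 eq. (6)] -/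
theorem exists_schrodinger_level_ge (a a₀ ms v a' b' : LinearMap.BilinForm ℝ V)
    (ha'_symm : ∀ x y, a' x y = a' y x) (hb'_symm : ∀ x y, b' x y = b' y x)
    (hb'_nonneg : ∀ x, 0 ≤ b' x x)
    (hv_nonneg : ∀ x, 0 ≤ v x x) {Vmax σ : ℝ} (hv_le : ∀ x, v x x ≤ Vmax * ms x x) (hσ : Vmax < σ)
    (hσpos : 0 < σ) (ha₀_le : ∀ x, a₀ x x + v x x ≤ a x x)
    {k m : ℕ} (hmk : m < k) (u : Fin k → V) (lam : Fin k → ℝ) {lo C s : ℝ}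
    (hms_on : ∀ i j, ms (u i) (u j) = if i = j then 1 else 0)
    (ha_on : ∀ i j, a (u i) (u j) = if i = j then lam i else 0)
    (hlo : lo ≤ 1) (hC : 0 < C) (hs : 0 < s) (hrow : lo * (1 + C ^ 2 * s) ≤ s)
    (ha'_le : ∀ x, a' x x ≤ a₀ x x) (hb_le : ∀ x, σ * ms x x - v x x ≤ b' x x)
    (proj : V →ₗ[ℝ] V) (ℓ : Fin m → V →ₗ[ℝ] ℝ)
    (horth : ∀ φ ∈ Submodule.span ℝ (Set.range u), a' (proj φ) (φ - proj φ) = 0)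
    (happrox : ∀ φ ∈ Submodule.span ℝ (Set.range u),
      b' (φ - proj φ) (φ - proj φ) ≤ C ^ 2 * a' (φ - proj φ) (φ - proj φ))
    (hcoer : ∀ φ ∈ Submodule.span ℝ (Set.range u), (∀ j, ℓ j (proj φ) = 0) →
      s * b' (proj φ) (proj φ) ≤ a' (proj φ) (proj φ)) :
    ∃ i, lo * σ ≤ lam i := by
  classical
  by_contra hne
  push Not at hne
  have hkpos : 0 < k := lt_of_le_of_lt (Nat.zero_le m) hmk
  haveI : Nonempty (Fin k) := ⟨⟨0, hkpos⟩⟩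
  obtain ⟨i₀, -, hi₀⟩ := Finset.exists_max_image Finset.univ lam Finset.univ_nonempty
  -- Λ := (max level)/σ < lo ≤ 1
  set Λ : ℝ := lam i₀ / σ with hΛdef
  have hlam : ∀ i, lam i ≤ Λ * σ := fun i => by
    rw [hΛdef, div_mul_cancel₀ _ hσpos.ne']
    exact hi₀ i (Finset.mem_univ i)
  have hΛlt : Λ < lo := by
    rw [hΛdef, div_lt_iff₀ hσpos]
    exact hne i₀
  have hΛ1 : Λ ≤ 1 := by linarith
  have hmain := liu_schrodinger_count_bound a a₀ ms v a' b' ha'_symm hb'_symm hb'_nonneg hv_nonneg hv_le hσ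
    ha₀_le hmk u lam hms_on ha_on hlam hΛ1 hC hs ha'_le hb_le proj ℓ horth happrox hcoer
  have hden : (0 : ℝ) < 1 + C ^ 2 * s := by positivity
  have h1 : Λ * (1 + C ^ 2 * s) < lo * (1 + C ^ 2 * s) := mul_lt_mul_of_pos_right hΛlt hden
  linarith

/-- **Birman–Schwinger comparison count (counting form, any family size).** Same setting, for an
`ms`-orthonormal `a`-diagonal family `u` of ANY size `k` (hypotheses on `span u`): at most `m` of its levels lie
below `lo·σ`. For the increasing enumeration of the exact eigenvalues of a client's Schrödinger-type operator
(`−Δ + V`, or `−Δ*` after `u = √R·w`) this reads `λ_{m+1} ≥ lo·σ`: a certified count `m` for the matrices of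
the pencil `(a', b'_σ)` at level `s` with `lo·(1 + C²s) ≤ s` bounds the number of eigenvalues below `lo·σ`.
[cite: FrankLaptevWeidl2022, Thm 1.52 (§1.2.8, Birman–Schwinger principle, `≤` direction) with Thm 1.25]
[cite: Liu2015, Thm 2.1 eq. (6) (counting form)] -/
theorem card_schrodinger_lt_le (a a₀ ms v a' b' : LinearMap.BilinForm ℝ V)
    (ha'_symm : ∀ x y, a' x y = a' y x) (hb'_symm : ∀ x y, b' x y = b' y x)
    (hb'_nonneg : ∀ x, 0 ≤ b' x x)
    (hv_nonneg : ∀ x, 0 ≤ v x x) {Vmax σ : ℝ} (hv_le : ∀ x, v x x ≤ Vmax * ms x x) (hσ : Vmax < σ)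
    (hσpos : 0 < σ) (ha₀_le : ∀ x, a₀ x x + v x x ≤ a x x)
    {k m : ℕ} (u : Fin k → V) (lam : Fin k → ℝ) {lo C s : ℝ}
    (hms_on : ∀ i j, ms (u i) (u j) = if i = j then 1 else 0)
    (ha_on : ∀ i j, a (u i) (u j) = if i = j then lam i else 0)
    (hlo : lo ≤ 1) (hC : 0 < C) (hs : 0 < s) (hrow : lo * (1 + C ^ 2 * s) ≤ s)
    (ha'_le : ∀ x, a' x x ≤ a₀ x x) (hb_le : ∀ x, σ * ms x x - v x x ≤ b' x x)
    (proj : V →ₗ[ℝ] V) (ℓ : Fin m → V →ₗ[ℝ] ℝ)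
    (horth : ∀ φ ∈ Submodule.span ℝ (Set.range u), a' (proj φ) (φ - proj φ) = 0)
    (happrox : ∀ φ ∈ Submodule.span ℝ (Set.range u),
      b' (φ - proj φ) (φ - proj φ) ≤ C ^ 2 * a' (φ - proj φ) (φ - proj φ))
    (hcoer : ∀ φ ∈ Submodule.span ℝ (Set.range u), (∀ j, ℓ j (proj φ) = 0) →
      s * b' (proj φ) (proj φ) ≤ a' (proj φ) (proj φ)) :
    Fintype.card {i : Fin k // lam i < lo * σ} ≤ m := by
  classical
  by_contra hlt
  push Not at hlt
  set k' := Fintype.card {i : Fin k // lam i < lo * σ} with hk'def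
  let e : Fin k' ≃ {i : Fin k // lam i < lo * σ} := (Fintype.equivFin _).symm
  let u' : Fin k' → V := fun i => u (e i).1
  let lam' : Fin k' → ℝ := fun i => lam (e i).1
  have hinj : ∀ i j : Fin k', (e i).1 = (e j).1 ↔ i = j := fun i j =>
    ⟨fun h => e.injective (Subtype.ext h), fun h => by rw [h]⟩
  have hms_on' : ∀ i j, ms (u' i) (u' j) = if i = j then 1 else 0 := by
    intro i j
    show ms (u (e i).1) (u (e j).1) = _
    rw [hms_on]
    by_cases hij : i = j
    · rw [if_pos ((hinj i j).mpr hij), if_pos hij]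
    · rw [if_neg (fun h => hij ((hinj i j).mp h)), if_neg hij]
  have ha_on' : ∀ i j, a (u' i) (u' j) = if i = j then lam' i else 0 := by
    intro i j
    show a (u (e i).1) (u (e j).1) = _
    rw [ha_on]
    by_cases hij : i = j
    · rw [if_pos ((hinj i j).mpr hij), if_pos hij]
    · rw [if_neg (fun h => hij ((hinj i j).mp h)), if_neg hij]
  have hspan : Submodule.span ℝ (Set.range u') ≤ Submodule.span ℝ (Set.range u) :=
    Submodule.span_mono (by rintro _ ⟨i, rfl⟩; exact ⟨(e i).1, rfl⟩)
  obtain ⟨i, hi⟩ := exists_schrodinger_level_ge a a₀ ms v a' b' ha'_symm hb'_symm hb'_nonneg hv_nonneg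
    hv_le hσ hσpos ha₀_le hlt u' lam' hms_on' ha_on' hlo hC hs hrow ha'_le hb_le proj ℓ
    (fun φ hφ => horth φ (hspan hφ)) (fun φ hφ => happrox φ (hspan hφ)) (fun φ hφ => hcoer φ (hspan hφ))
  exact absurd (e i).2 (not_lt.mpr hi)

end Literature.Analysis.OperatorTheory
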